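import Mathlib.Analysis.SpecialFunctions.Pow.Real
import HarnessLib

/-!
# The numerical certificate behind `γ'_2 = 3.931` (Alman–Li 2026, Table 1 / Thm. 1.3)

Topic `Literature/Computability/AlgebraicComplexity` (family `MatrixMultiplication`). Source: J. Alman,
B. Li, *Asymptotic Rank Speedup Theorems, Revisited*, arXiv:2605.21738 (2026), §7.1 (held text
`paper:arxiv-2605.21738`, p0017 L109–122) and Table 1: `R̃(cw_2) ≤ γ'_2 = 3.931` is
`max_{θ∈[2/3,1]} F(θ)` (to the fourth root) for `q = 2`, `n = 4`, i.e. `r = 256`, `s = 16`,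
`t = 110`, `t' = t² + 2·81² = 25222`, "computed via computer-aided evaluation; in fact, the
maximizing `θ` … equals `θ = 2/3`".

This file supplies a KERNEL certificate for that maximisation in the form consumed by
`AlmanLi2026.asymptoticRank_le_of_iterated_certificate` (`AlmanLi2026IteratedSpectrumBound.lean`):
with `c = 238.7878` (`c < 3.931⁴ = 238.78782…`, so `c^{1/4} < 3.931`),
`(256 + 16^θ)² ≤ c² + 2c·110^θ + 25222^θ` for all `θ ∈ [2/3, 1]`
(`AlmanLi2026.gammaPrime_two_certificate`).  Method (ours, elementary): split `[2/3,1]` at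
`167/250, 27/40, 7/10, 18/25, 4/5`; on each piece bound `16^θ` above at the right end and
`110^θ, 25222^θ` below at the left end (monotone in the exponent), each bound being a rational
`p/q`-power certificate checked on integers (`16^p ≤ U^q` etc., `norm_num`); the pieces are fine
near `θ = 2/3`, where the printed maximum sits and the margin is ≈ `6·10⁻⁵` relative (first piece to four decimals).  Pure real arithmetic; imports Mathlib only;
no named facts.  The consequence `R̃(cw_2) < 3.931` (Thm. 1.3) follows with the §7.1 display
(fact `AlmanLi2026_iteratedSpeedup_cw`) in `AlmanLi2026IteratedSpectrumBound`'s corollary; it is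
drawn where that display is available.

## References

* J. Alman, B. Li, *Asymptotic Rank Speedup Theorems, Revisited*, arXiv:2605.21738 (2026), §7.1,
  Table 1, Thm. 1.3. [AlmanLi2026]
-/

noncomputable section

namespace Literature.Computability.AlgebraicComplexity

namespace AlmanLi2026

/-- Lower `p/q`-power certificate: `L^q ≤ x^p ⟹ L ≤ x^{p/q}` (`x > 0`, `L ≥ 0`). [folklore] -/
private theorem le_rpow_div_of_pow_le {x L : ℝ} {p q : ℕ} (hx : 0 < x) (hq : q ≠ 0)
    (h : L ^ q ≤ x ^ p) : L ≤ x ^ (((p : ℕ) : ℝ) / ((q : ℕ) : ℝ)) := by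
  have hq' : ((q : ℕ) : ℝ) ≠ 0 := Nat.cast_ne_zero.2 hq
  have e : (x ^ (((p : ℕ) : ℝ) / ((q : ℕ) : ℝ))) ^ q = x ^ p := by
    rw [← Real.rpow_natCast, ← Real.rpow_mul hx.le, div_mul_cancel₀ _ hq', Real.rpow_natCast]
  exact le_of_pow_le_pow_left₀ hq (Real.rpow_nonneg hx.le _) (by rw [e]; exact h)

/-- Upper `p/q`-power certificate: `x^p ≤ U^q ⟹ x^{p/q} ≤ U` (`x > 0`, `U ≥ 0`). [folklore] -/
private theorem rpow_div_le_of_pow_le {x U : ℝ} {p q : ℕ} (hx : 0 < x) (hU : 0 ≤ U) (hq : q ≠ 0)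
    (h : x ^ p ≤ U ^ q) : x ^ (((p : ℕ) : ℝ) / ((q : ℕ) : ℝ)) ≤ U := by
  have hq' : ((q : ℕ) : ℝ) ≠ 0 := Nat.cast_ne_zero.2 hq
  have e : (x ^ (((p : ℕ) : ℝ) / ((q : ℕ) : ℝ))) ^ q = x ^ p := by
    rw [← Real.rpow_natCast, ← Real.rpow_mul hx.le, div_mul_cancel₀ _ hq', Real.rpow_natCast]
  exact le_of_pow_le_pow_left₀ hq hU (by rw [e]; exact h)

/-- One piece of the certificate: on `θ ∈ [a, b]`, bounds `16^b ≤ U`, `L₁ ≤ 110^a`, `L₂ ≤ 25222^a`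
and the rational check `(256 + U)² ≤ c² + 2cL₁ + L₂` give the inequality. [folklore] -/
private theorem piece {θ a b U L₁ L₂ c : ℝ} (ha : a ≤ θ) (hb : θ ≤ b) (hc : 0 ≤ c)
    (hU : (16 : ℝ) ^ b ≤ U) (hL₁ : L₁ ≤ (110 : ℝ) ^ a) (hL₂ : L₂ ≤ (25222 : ℝ) ^ a)
    (hnum : (256 + U) ^ 2 ≤ c ^ 2 + 2 * c * L₁ + L₂) :
    (256 + (16 : ℝ) ^ θ) ^ 2 ≤ c ^ 2 + 2 * c * (110 : ℝ) ^ θ + (25222 : ℝ) ^ θ := by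
  have h16 : (16 : ℝ) ^ θ ≤ U :=
    (Real.rpow_le_rpow_of_exponent_le (by norm_num) hb).trans hU
  have h110 : L₁ ≤ (110 : ℝ) ^ θ :=
    hL₁.trans (Real.rpow_le_rpow_of_exponent_le (by norm_num) ha)
  have h252 : L₂ ≤ (25222 : ℝ) ^ θ :=
    hL₂.trans (Real.rpow_le_rpow_of_exponent_le (by norm_num) ha)
  have h0 : 0 ≤ (16 : ℝ) ^ θ := Real.rpow_nonneg (by norm_num) _
  have hsq : (256 + (16 : ℝ) ^ θ) ^ 2 ≤ (256 + U) ^ 2 :=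
    pow_le_pow_left₀ (by linarith) (by linarith) 2
  nlinarith [mul_le_mul_of_nonneg_left h110 (by linarith : (0:ℝ) ≤ 2 * c)]

/-- **The certificate for `γ'_2` (Alman–Li 2026, Table 1: `q = 2`, `n = 4`, maximiser `θ = 2/3`)**:
with `c = 238.7878` (so `c^{1/4} < 3.931`), `(256 + 16^θ)² ≤ c² + 2c·110^θ + 25222^θ` for all
`θ ∈ [2/3, 1]`. [cite: AlmanLi2026, §7.1 (max_θ F(θ), Table 1)] -/
theorem gammaPrime_two_certificate (θ : ℝ) (h₁ : 2 / 3 ≤ θ) (h₂ : θ ≤ 1) :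
    (256 + (16 : ℝ) ^ θ) ^ 2 ≤
      (1193939 / 5000 : ℝ) ^ 2 + 2 * (1193939 / 5000 : ℝ) * (110 : ℝ) ^ θ + (25222 : ℝ) ^ θ := by
  have hc : (0 : ℝ) ≤ (1193939 / 5000 : ℝ) := by norm_num
  by_cases hb0 : θ ≤ (167 / 250 : ℝ)
  · -- piece [2/3, 167/250]
    have hU : (16 : ℝ) ^ (((167 : ℕ) : ℝ) / ((250 : ℕ) : ℝ)) ≤ (15933 / 2500 : ℝ) :=
      rpow_div_le_of_pow_le (by norm_num) (by norm_num) (by norm_num) (by norm_num)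
    have hL₁ : (229577 / 10000 : ℝ) ≤ (110 : ℝ) ^ (((2 : ℕ) : ℝ) / ((3 : ℕ) : ℝ)) :=
      le_rpow_div_of_pow_le (by norm_num) (by norm_num) (by norm_num)
    have hL₂ : (430021 / 500 : ℝ) ≤ (25222 : ℝ) ^ (((2 : ℕ) : ℝ) / ((3 : ℕ) : ℝ)) :=
      le_rpow_div_of_pow_le (by norm_num) (by norm_num) (by norm_num)
    have ea : (((2 : ℕ) : ℝ) / ((3 : ℕ) : ℝ)) = (2 / 3 : ℝ) := by norm_num
    have eb : (((167 : ℕ) : ℝ) / ((250 : ℕ) : ℝ)) = (167 / 250 : ℝ) := by norm_num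
    rw [ea] at hL₁ hL₂
    rw [eb] at hU
    exact piece (by linarith) (by linarith) hc hU hL₁ hL₂ (by norm_num)
  have ha0 : (167 / 250 : ℝ) ≤ θ := le_of_lt (lt_of_not_ge hb0)
  by_cases hb1 : θ ≤ (27 / 40 : ℝ)
  · -- piece [167/250, 27/40]
    have hU : (16 : ℝ) ^ (((27 : ℕ) : ℝ) / ((40 : ℕ) : ℝ)) ≤ (13 / 2 : ℝ) :=
      rpow_div_le_of_pow_le (by norm_num) (by norm_num) (by norm_num) (by norm_num)
    have hL₁ : (231 / 10 : ℝ) ≤ (110 : ℝ) ^ (((167 : ℕ) : ℝ) / ((250 : ℕ) : ℝ)) :=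
      le_rpow_div_of_pow_le (by norm_num) (by norm_num) (by norm_num)
    have hL₂ : (43587 / 50 : ℝ) ≤ (25222 : ℝ) ^ (((167 : ℕ) : ℝ) / ((250 : ℕ) : ℝ)) :=
      le_rpow_div_of_pow_le (by norm_num) (by norm_num) (by norm_num)
    have ea : (((167 : ℕ) : ℝ) / ((250 : ℕ) : ℝ)) = (167 / 250 : ℝ) := by norm_num
    have eb : (((27 : ℕ) : ℝ) / ((40 : ℕ) : ℝ)) = (27 / 40 : ℝ) := by norm_num
    rw [ea] at hL₁ hL₂
    rw [eb] at hU
    exact piece (by linarith) (by linarith) hc hU hL₁ hL₂ (by norm_num)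
  have ha1 : (27 / 40 : ℝ) ≤ θ := le_of_lt (lt_of_not_ge hb1)
  by_cases hb2 : θ ≤ (7 / 10 : ℝ)
  · -- piece [27/40, 7/10]
    have hU : (16 : ℝ) ^ (((7 : ℕ) : ℝ) / ((10 : ℕ) : ℝ)) ≤ (697 / 100 : ℝ) :=
      rpow_div_le_of_pow_le (by norm_num) (by norm_num) (by norm_num) (by norm_num)
    have hL₁ : (2387 / 100 : ℝ) ≤ (110 : ℝ) ^ (((27 : ℕ) : ℝ) / ((40 : ℕ) : ℝ)) :=
      le_rpow_div_of_pow_le (by norm_num) (by norm_num) (by norm_num)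
    have hL₂ : (93583 / 100 : ℝ) ≤ (25222 : ℝ) ^ (((27 : ℕ) : ℝ) / ((40 : ℕ) : ℝ)) :=
      le_rpow_div_of_pow_le (by norm_num) (by norm_num) (by norm_num)
    have ea : (((27 : ℕ) : ℝ) / ((40 : ℕ) : ℝ)) = (27 / 40 : ℝ) := by norm_num
    have eb : (((7 : ℕ) : ℝ) / ((10 : ℕ) : ℝ)) = (7 / 10 : ℝ) := by norm_num
    rw [ea] at hL₁ hL₂
    rw [eb] at hU
    exact piece (by linarith) (by linarith) hc hU hL₁ hL₂ (by norm_num)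
  have ha2 : (7 / 10 : ℝ) ≤ θ := le_of_lt (lt_of_not_ge hb2)
  by_cases hb3 : θ ≤ (18 / 25 : ℝ)
  · -- piece [7/10, 18/25]
    have hU : (16 : ℝ) ^ (((18 : ℕ) : ℝ) / ((25 : ℕ) : ℝ)) ≤ (737 / 100 : ℝ) :=
      rpow_div_le_of_pow_le (by norm_num) (by norm_num) (by norm_num) (by norm_num)
    have hL₁ : (537 / 20 : ℝ) ≤ (110 : ℝ) ^ (((7 : ℕ) : ℝ) / ((10 : ℕ) : ℝ)) :=
      le_rpow_div_of_pow_le (by norm_num) (by norm_num) (by norm_num)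
    have hL₂ : (120571 / 100 : ℝ) ≤ (25222 : ℝ) ^ (((7 : ℕ) : ℝ) / ((10 : ℕ) : ℝ)) :=
      le_rpow_div_of_pow_le (by norm_num) (by norm_num) (by norm_num)
    have ea : (((7 : ℕ) : ℝ) / ((10 : ℕ) : ℝ)) = (7 / 10 : ℝ) := by norm_num
    have eb : (((18 : ℕ) : ℝ) / ((25 : ℕ) : ℝ)) = (18 / 25 : ℝ) := by norm_num
    rw [ea] at hL₁ hL₂
    rw [eb] at hU
    exact piece (by linarith) (by linarith) hc hU hL₁ hL₂ (by norm_num)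
  have ha3 : (18 / 25 : ℝ) ≤ θ := le_of_lt (lt_of_not_ge hb3)
  by_cases hb4 : θ ≤ (4 / 5 : ℝ)
  · -- piece [18/25, 4/5]
    have hU : (16 : ℝ) ^ (((4 : ℕ) : ℝ) / ((5 : ℕ) : ℝ)) ≤ (919 / 100 : ℝ) :=
      rpow_div_le_of_pow_le (by norm_num) (by norm_num) (by norm_num) (by norm_num)
    have hL₁ : (2949 / 100 : ℝ) ≤ (110 : ℝ) ^ (((18 : ℕ) : ℝ) / ((25 : ℕ) : ℝ)) :=
      le_rpow_div_of_pow_le (by norm_num) (by norm_num) (by norm_num)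
    have hL₂ : (73833 / 50 : ℝ) ≤ (25222 : ℝ) ^ (((18 : ℕ) : ℝ) / ((25 : ℕ) : ℝ)) :=
      le_rpow_div_of_pow_le (by norm_num) (by norm_num) (by norm_num)
    have ea : (((18 : ℕ) : ℝ) / ((25 : ℕ) : ℝ)) = (18 / 25 : ℝ) := by norm_num
    have eb : (((4 : ℕ) : ℝ) / ((5 : ℕ) : ℝ)) = (4 / 5 : ℝ) := by norm_num
    rw [ea] at hL₁ hL₂
    rw [eb] at hU
    exact piece (by linarith) (by linarith) hc hU hL₁ hL₂ (by norm_num)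
  have ha4 : (4 / 5 : ℝ) ≤ θ := le_of_lt (lt_of_not_ge hb4)
  -- piece [4/5, 1]
  have hU : (16 : ℝ) ^ (((1 : ℕ) : ℝ) / ((1 : ℕ) : ℝ)) ≤ (16 : ℝ) :=
    rpow_div_le_of_pow_le (by norm_num) (by norm_num) (by norm_num) (by norm_num)
  have hL₁ : (1074 / 25 : ℝ) ≤ (110 : ℝ) ^ (((4 : ℕ) : ℝ) / ((5 : ℕ) : ℝ)) :=
    le_rpow_div_of_pow_le (by norm_num) (by norm_num) (by norm_num)
  have hL₂ : (166109 / 50 : ℝ) ≤ (25222 : ℝ) ^ (((4 : ℕ) : ℝ) / ((5 : ℕ) : ℝ)) :=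
    le_rpow_div_of_pow_le (by norm_num) (by norm_num) (by norm_num)
  have ea : (((4 : ℕ) : ℝ) / ((5 : ℕ) : ℝ)) = (4 / 5 : ℝ) := by norm_num
  have eb : (((1 : ℕ) : ℝ) / ((1 : ℕ) : ℝ)) = (1 : ℝ) := by norm_num
  rw [ea] at hL₁ hL₂
  rw [eb] at hU
  exact piece (by linarith) (by linarith) hc hU hL₁ hL₂ (by norm_num)

/-- `c^{1/4} < 3.931` for the certificate's `c = 238.7878` (`3.931⁴ = 238.78782…`).
[cite: AlmanLi2026, Table 1] -/
theorem gammaPrime_two_root_lt : (1193939 / 5000 : ℝ) ^ ((4 : ℝ)⁻¹) < 3.931 := by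
  have h4 : ((1193939 / 5000 : ℝ) ^ ((4 : ℝ)⁻¹)) ^ (4 : ℕ) = (1193939 / 5000 : ℝ) := by
    rw [← Real.rpow_natCast, ← Real.rpow_mul (by norm_num)]
    norm_num
  by_contra hc
  have hle : (3.931 : ℝ) ≤ (1193939 / 5000 : ℝ) ^ ((4 : ℝ)⁻¹) := le_of_not_gt hc
  have := pow_le_pow_left₀ (by norm_num) hle 4
  rw [h4] at this
  norm_num at this

end AlmanLi2026

end Literature.Computability.AlgebraicComplexity
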